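import Summits.QuantumFields.YangMills.Theorems.AllWindowsColdBoxBoxHighLineHodgeEntries
import Summits.QuantumFields.YangMills.Theorems.AllWindowsColdBoxBoxKernelGreen

/-!
# LINE-19 S3b / LINE-20 U1 — STUB-PLAN-U1 §7.2, step 2: the rest block of `hodgeQ` IS the direct sum of D/N box Laplacians

With `Rest H` the rest links of the cold box (an endpoint interior) and `Skin H` the others, the bijection
`restSigma : Rest H ≃ Σ μ, BoxKernel.Box 4 (2H) (univ.erase μ)` (base point ↦ its coordinates) identifies the rest × rest block of the Hodge
precision matrix with the block-diagonal matrix of the scalar box Laplacians `boxLap (2H) (univ.erase μ)` (Dirichlet faces transverse to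
`μ`, Neumann faces in the direction `μ`) — `hodgeQ_rest_eq_blockDiagonal` — whose inverse `restInv` (`restBlock_mul_restInv`, symmetric:
`restInv_transpose`) is therefore read, block by block, from the landed box Green functions (`BoxKernel.boxLap_inv_eq`), entrywise:
`restInv_apply_of_ne` / `restInv_apply_of_eq`.

Everything proved; standard axioms.  HONEST LABEL: bookkeeping toward stub S3b (`LandauKernelDecay`, ⟨stmt-QuantumFields-24004⟩/⟨24335⟩,
U1 of ⟨24336⟩) of a critic-stamped line on the R2ξ″ crux; no stub is closed by name here, no crux, rung or summit is proved; the
Yang–Mills mass gap is NOT proved by this file.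
-/

set_option autoImplicit false

noncomputable section

namespace Summit.QuantumFields.YangMills.Theorems.AllWindowsColdBoxBoxHighLine

open Finset Matrix
open Literature.Probability.LatticeModels (Site)
open Literature.MathematicalPhysics.QuantumFieldTheory
open Literature.MathematicalPhysics.QuantumFieldTheory.LatticeMaxwell
open Literature.MathematicalPhysics.QuantumFieldTheory.AxialGauge
open Summit.QuantumFields.YangMills.Theorems.WeakCouplingRates
open Summit.QuantumFields.YangMills.Theorems.AllWindowsColdBox.BoxKernel

namespace RestBlock

variable {H : ℕ}

/-! ## Rest and skin links -/

variable (H) in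
/-- The REST links of the cold box: at least one endpoint is an interior site. -/
abbrev Rest : Type := {e : LandauFree H // e.1.1.1 ∈ interiorSites H ∨ e.1.1.1 + Pi.single e.1.1.2 1 ∈ interiorSites H}

variable (H) in
/-- The SKIN links of the cold box: no endpoint is an interior site (the links lying in a face). -/
abbrev Skin : Type := {e : LandauFree H // ¬ (e.1.1.1 ∈ interiorSites H ∨ e.1.1.1 + Pi.single e.1.1.2 1 ∈ interiorSites H)}

/-- A rest link is a rest link in coordinates. -/
theorem isRest_rest (r : Rest H) : IsRest H r.1.1.1.1 r.1.1.1.2 := isRest_of_mem_or_mem r.2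

/-- There are rest links only for `H ≥ 1`. -/
theorem one_le_of_rest (r : Rest H) : 1 ≤ H := by
  have h := isRest_rest r
  rcases r.2 with h2 | h2
  · have := (mem_interiorSites_iff _).1 h2 (r.1.1.1.2); omega
  · have := (mem_interiorSites_iff _).1 h2 (r.1.1.1.2); simp [Pi.add_apply] at this; omega

/-! ## Rest links of direction `μ` as points of the box `Box 4 (2H) (univ.erase μ)` -/

/-- The box point of a rest link `(x, μ)`: its integer coordinates (in `[1, 2H−1]` transversally, `[0, 2H−1]` longitudinally). -/
def toBox (μ : Fin 4) (x : Site 4) (h : IsRest H x μ) : Box 4 (2 * H) (univ.erase μ) :=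
  ⟨fun k => ⟨(x k).toNat, by
      have h0 : 0 ≤ x k ∧ x k ≤ 2 * (H : ℤ) - 1 := by
        by_cases hk : k = μ
        · subst hk; exact ⟨h.2.1, h.2.2⟩
        · have := h.1 k hk; omega
      omega⟩,
    fun ν hν => by
      have hne : ν ≠ μ := Finset.ne_of_mem_erase hν
      have := h.1 ν hne
      simp only [ne_eq]
      omega⟩

/-- The coordinates of the box point of a rest link are those of its base point. -/
theorem coords_toBox (μ : Fin 4) (x : Site 4) (h : IsRest H x μ) : coords (toBox μ x h) = x := by
  funext k
  have h0 : 0 ≤ x k := by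
    by_cases hk : k = μ
    · subst hk; exact h.2.1
    · have := h.1 k hk; omega
  simp [coords, toBox, Int.toNat_of_nonneg h0]

/-- The natural-number coordinates of the box point, cast to `ℝ`, are the integer coordinates cast to `ℝ`. -/
theorem toBox_apply_cast (μ : Fin 4) (x : Site 4) (h : IsRest H x μ) (k : Fin 4) :
    ((((toBox μ x h).1 k : ℕ)) : ℝ) = ((x k : ℤ) : ℝ) := by
  have := congrFun (coords_toBox μ x h) k
  simp only [coords] at this
  exact_mod_cast this

/-- `toBox` is injective on base points. -/
theorem toBox_eq_toBox_iff (μ : Fin 4) {x x' : Site 4} (h : IsRest H x μ) (h' : IsRest H x' μ) :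
    toBox μ x' h' = toBox μ x h ↔ x' = x := by
  constructor
  · intro heq
    have := congrArg coords heq
    rwa [coords_toBox, coords_toBox] at this
  · intro heq; subst heq; rfl

/-- A box point gives a rest link of direction `μ` (its coordinates as base point). -/
theorem isRest_coords (μ : Fin 4) (s : Box 4 (2 * H) (univ.erase μ)) : IsRest H (coords s) μ := by
  refine ⟨fun ν hν => ?_, ?_, ?_⟩
  · have h1 := s.2 ν (Finset.mem_erase.2 ⟨hν, Finset.mem_univ _⟩)
    have h2 := (s.1 ν).isLt
    simp only [coords]
    constructor <;> omega
  · simp [coords]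
  · have h2 := (s.1 μ).isLt
    simp only [coords]
    omega

/-- The free edge of the cold box with base point `coords s` and direction `μ`. -/
def ofBox (μ : Fin 4) (s : Box 4 (2 * H) (univ.erase μ)) : Rest H :=
  ⟨⟨⟨(coords s, μ), by
      rw [mem_boxEdgesAt, mem_boxEdges_iff]
      have hr := isRest_coords (H := H) μ s
      refine ⟨fun k => ?_, ?_⟩
      · have h0 : 0 ≤ coords s k ∧ coords s k ≤ 2 * (H : ℤ) - 1 := by
          by_cases hk : k = μ
          · subst hk; exact ⟨hr.2.1, hr.2.2⟩
          · have := hr.1 k hk; omega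
        simp only [Pi.sub_apply, dirCorner]
        push_cast
        omega
      · have := hr.2.2
        simp only [Pi.sub_apply, dirCorner]
        push_cast
        omega⟩, by
      have hr := isRest_coords (H := H) μ s
      simp only [landauPin, not_not, mem_boxEdges_iff]
      refine ⟨fun k => ?_, ?_⟩
      · have h0 : 0 ≤ coords s k ∧ coords s k ≤ 2 * (H : ℤ) - 1 := by
          by_cases hk : k = μ
          · subst hk; exact ⟨hr.2.1, hr.2.2⟩
          · have := hr.1 k hk; omega
        push_cast; omega
      · have := hr.2.2; push_cast; omega⟩,
    mem_or_mem_of_isRest (by have := (s.1 μ).isLt; omega) (isRest_coords μ s)⟩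

/-- `toBox ∘ ofBox = id`. -/
theorem toBox_coords (μ : Fin 4) (s : Box 4 (2 * H) (univ.erase μ)) (h : IsRest H (coords s) μ) : toBox μ (coords s) h = s := by
  apply Subtype.ext
  funext k
  apply Fin.ext
  simp [toBox, coords]

/-- **The rest links are the disjoint union over directions of the D/N boxes**: `Rest H ≃ Σ μ, Box 4 (2H) (univ.erase μ)`. -/
def restSigma : Rest H ≃ Σ μ : Fin 4, Box 4 (2 * H) (univ.erase μ) where
  toFun r := ⟨r.1.1.1.2, toBox r.1.1.1.2 r.1.1.1.1 (isRest_rest r)⟩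
  invFun q := ofBox q.1 q.2
  left_inv r := by
    obtain ⟨⟨⟨⟨x, μ⟩, hb⟩, hp⟩, hr⟩ := r
    apply Subtype.ext; apply Subtype.ext; apply Subtype.ext
    change (coords (toBox μ x (isRest_of_mem_or_mem hr)), μ) = (x, μ)
    rw [coords_toBox]
  right_inv q := by
    obtain ⟨μ, s⟩ := q
    change (⟨μ, toBox μ (coords s) (isRest_rest (ofBox μ s))⟩ : Σ μ : Fin 4, Box 4 (2 * H) (univ.erase μ)) = ⟨μ, s⟩
    rw [toBox_coords]

/-- The direction component of `restSigma`. -/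
theorem restSigma_fst (r : Rest H) : (restSigma r).1 = r.1.1.1.2 := rfl

/-! ## The rest block is block diagonal -/

/-- **§7.2: the rest × rest block of `hodgeQ` is the block-diagonal matrix of the D/N box Laplacians** under `restSigma`. -/
theorem hodgeQ_rest_eq_blockDiagonal (r r' : Rest H) :
    hodgeQ H r.1 r'.1 = Matrix.blockDiagonal' (fun μ => boxLap (2 * H) (univ.erase μ)) (restSigma r) (restSigma r') := by
  obtain ⟨⟨⟨⟨x, μ⟩, hb⟩, hp⟩, hr⟩ := r
  obtain ⟨⟨⟨⟨x', μ'⟩, hb'⟩, hp'⟩, hr'⟩ := r'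
  have he : IsRest H x μ := isRest_of_mem_or_mem hr
  have he' : IsRest H x' μ' := isRest_of_mem_or_mem hr'
  by_cases hμ : μ = μ'
  · subst hμ
    change hodgeQ H ⟨⟨(x, μ), hb⟩, hp⟩ ⟨⟨(x', μ), hb'⟩, hp'⟩ =
      Matrix.blockDiagonal' (fun μ => boxLap (2 * H) (univ.erase μ)) ⟨μ, toBox μ x he⟩ ⟨μ, toBox μ x' he'⟩
    rw [Matrix.blockDiagonal'_apply_eq, hodgeQ_entry_rest_of_eq (H := H) ⟨⟨(x, μ), hb⟩, hp⟩ ⟨⟨(x', μ), hb'⟩, hp'⟩ rfl he he']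
    simp only [boxLap, Matrix.of_apply, coords_toBox, toBox_eq_toBox_iff, upCoeff, downCoeff, Finset.mem_erase, Finset.mem_univ,
      and_true]
    refine Finset.sum_congr rfl fun ν _ => ?_
    have hcμ : ((toBox μ x he).1 μ : ℕ) = (x μ).toNat := rfl
    have hx0 : 0 ≤ x μ := he.2.1
    have c1 : (ν ≠ μ ∨ x μ + 1 < 2 * (H : ℤ)) ↔ (ν ≠ μ ∨ ((toBox μ x he).1 ν : ℕ) + 1 < 2 * H) := by
      by_cases hν : ν = μ
      · subst hν; rw [hcμ]; simp only [ne_eq, not_true, false_or]; omega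
      · simp [hν]
    have c2 : (ν ≠ μ ∨ 1 ≤ x μ) ↔ (ν ≠ μ ∨ 1 ≤ ((toBox μ x he).1 ν : ℕ)) := by
      by_cases hν : ν = μ
      · subst hν; rw [hcμ]; simp only [ne_eq, not_true, false_or]; omega
      · simp [hν]
    simp only [c1, c2]
  · change hodgeQ H ⟨⟨(x, μ), hb⟩, hp⟩ ⟨⟨(x', μ'), hb'⟩, hp'⟩ =
      Matrix.blockDiagonal' (fun μ => boxLap (2 * H) (univ.erase μ)) ⟨μ, toBox μ x he⟩ ⟨μ', toBox μ' x' he'⟩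
    rw [Matrix.blockDiagonal'_apply_ne _ _ _ hμ]
    exact hodgeQ_entry_rest_of_ne (H := H) ⟨⟨(x, μ), hb⟩, hp⟩ ⟨⟨(x', μ'), hb'⟩, hp'⟩ hμ he he'

variable (H) in
/-- The rest × rest block of `hodgeQ`. -/
def restBlock : Matrix (Rest H) (Rest H) ℝ := Matrix.of fun r r' => hodgeQ H r.1 r'.1

variable (H) in
/-- Its inverse: the block-diagonal matrix of the box Green functions, pulled back along `restSigma`. -/
def restInv : Matrix (Rest H) (Rest H) ℝ :=
  Matrix.reindex restSigma.symm restSigma.symm (Matrix.blockDiagonal' fun μ => (boxLap (2 * H) (univ.erase μ))⁻¹)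

/-- The rest block as a reindexed block-diagonal matrix. -/
theorem restBlock_eq : restBlock H =
    Matrix.reindex restSigma.symm restSigma.symm (Matrix.blockDiagonal' fun μ => boxLap (2 * H) (univ.erase μ)) := by
  ext r r'
  simp only [restBlock, Matrix.of_apply, Matrix.reindex_apply, Matrix.submatrix_apply, Equiv.symm_symm]
  exact hodgeQ_rest_eq_blockDiagonal r r'

/-- The transverse Dirichlet set `univ.erase μ` is nonempty (`d = 4`). -/
theorem erase_nonempty (μ : Fin 4) : (Finset.univ.erase μ : Finset (Fin 4)).Nonempty := by
  rw [← Finset.card_pos, Finset.card_erase_of_mem (Finset.mem_univ _), Finset.card_univ, Fintype.card_fin]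
  norm_num

/-- **`restBlock * restInv = 1`.** -/
theorem restBlock_mul_restInv [NeZero H] : restBlock H * restInv H = 1 := by
  have hM : NeZero (2 * H) := ⟨by have := NeZero.ne H; omega⟩
  rw [restBlock_eq, restInv]
  simp only [Matrix.reindex_apply, Equiv.symm_symm]
  rw [Matrix.submatrix_mul_equiv, ← Matrix.blockDiagonal'_mul]
  have h1 : (fun μ : Fin 4 => boxLap (2 * H) (univ.erase μ) * (boxLap (2 * H) (univ.erase μ))⁻¹) =
      (1 : ∀ μ : Fin 4, Matrix (Box 4 (2 * H) (univ.erase μ)) (Box 4 (2 * H) (univ.erase μ)) ℝ) := by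
    funext μ
    rw [Pi.one_apply]
    exact Matrix.mul_nonsing_inv _ (isUnit_det_boxLap (erase_nonempty μ))
  rw [h1, Matrix.blockDiagonal'_one, Matrix.submatrix_one_equiv]

/-- The box Laplacian is symmetric. -/
theorem boxLap_transpose' (M : ℕ) (Dset : Finset (Fin 4)) : (boxLap M Dset)ᵀ = boxLap M Dset := by
  ext s t
  simp only [Matrix.transpose_apply, boxLap, Matrix.of_apply]
  refine Finset.sum_congr rfl fun ν _ => ?_
  have e1 : (if s = t then upCoeff M Dset ν t + downCoeff Dset ν t else (0 : ℝ)) =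
      (if t = s then upCoeff M Dset ν s + downCoeff Dset ν s else 0) := by
    by_cases h : s = t
    · subst h; simp
    · rw [if_neg h, if_neg (Ne.symm h)]
  have e2 : (coords s = coords t + Pi.single ν 1) ↔ (coords t = coords s - Pi.single ν 1) := by
    constructor <;> intro h <;> rw [h] <;> simp
  have e3 : (coords s = coords t - Pi.single ν 1) ↔ (coords t = coords s + Pi.single ν 1) := by
    constructor <;> intro h <;> rw [h] <;> simp
  rw [e1]
  simp only [e2, e3]
  ring

/-- **`restInv` is symmetric.** -/
theorem restInv_transpose : (restInv H)ᵀ = restInv H := by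
  rw [restInv]
  simp only [Matrix.reindex_apply, Matrix.transpose_submatrix, Matrix.blockDiagonal'_transpose]
  have h1 : (fun μ : Fin 4 => ((boxLap (2 * H) (univ.erase μ))⁻¹)ᵀ) = fun μ => (boxLap (2 * H) (univ.erase μ))⁻¹ := by
    funext μ
    rw [Matrix.transpose_nonsing_inv, boxLap_transpose']
  rw [h1]

/-- `restInv` vanishes between links of different directions. -/
theorem restInv_apply_of_ne (r r' : Rest H) (h : r.1.1.1.2 ≠ r'.1.1.1.2) : restInv H r r' = 0 := by
  simp only [restInv, Matrix.reindex_apply, Matrix.submatrix_apply, Equiv.symm_symm]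
  obtain ⟨⟨⟨⟨x, μ⟩, hb⟩, hp⟩, hr⟩ := r
  obtain ⟨⟨⟨⟨x', μ'⟩, hb'⟩, hp'⟩, hr'⟩ := r'
  exact Matrix.blockDiagonal'_apply_ne _ _ _ h

/-- Between links of the same direction `μ`, `restInv` is the box Green function `(boxLap (2H) (univ.erase μ))⁻¹` of the base points. -/
theorem restInv_apply_of_eq (μ : Fin 4) (r r' : Rest H) (hr : r.1.1.1.2 = μ) (hr' : r'.1.1.1.2 = μ) :
    restInv H r r' = (boxLap (2 * H) (univ.erase μ))⁻¹ (toBox μ r.1.1.1.1 (hr ▸ isRest_rest r)) (toBox μ r'.1.1.1.1 (hr' ▸ isRest_rest r')) := by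
  simp only [restInv, Matrix.reindex_apply, Matrix.submatrix_apply, Equiv.symm_symm]
  obtain ⟨⟨⟨⟨x, ν⟩, hb⟩, hp⟩, hx⟩ := r
  obtain ⟨⟨⟨⟨x', ν'⟩, hb'⟩, hp'⟩, hx'⟩ := r'
  change ν = μ at hr
  change ν' = μ at hr'
  subst hr; subst hr'
  exact Matrix.blockDiagonal'_apply_eq _ _ _ _

end RestBlock

end Summit.QuantumFields.YangMills.Theorems.AllWindowsColdBoxBoxHighLine

end
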